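import Summits.CriticalPhenomena.CardyFormulaZ2.Theses.CardyQContinuation
import Summits.CriticalPhenomena.CardyFormulaZ2.Theorems.CardyUSTContinuationBernoulliEndpoint
import Literature.Probability.Percolation.RussoFormula

/-!
# `BernoulliMatch` (route CardyQContinuation of `CardyFormulaZ2`, stmt-CriticalPhenomena-5562)

Item stmt-CriticalPhenomena-5562 (`BernoulliMatch`, support, rank 9): **at `s = 1` the self-dual
arc crossing ratio is the Bernoulli-`1/2` crossing probability**, `P_δ(1) = bondDomainCrossingProb R δ`
for every conformal rectangle `R` and every mesh `δ > 0`.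

Proof. At `s = 1` every weight `s ^ (|ω| + 2 k_B(ω))` equals `1`, so
`P_δ(1) = N_δ(1) / Z_δ(1) = #{ω ⊆ E(Ω_δ) : ω ∈ C_δ} / 2 ^ |E(Ω_δ)|`, where `E(Ω_δ)`, the edge set
of `discreteDomainGraph Ω δ`, is finite (`meshDomain_finite`, `R.isBounded`) and the `finsum`s over
`𝒫 E(Ω_δ)` are finite sums over `Finset.powerset`. On the other side, Smirnov's crossing event
`C_δ = discreteCrossing Ω δ (ab) (cd)` reads a configuration only through `openGraph ω ⊓ Ω_δ`,
i.e. through the edges of `Ω_δ` (`determinedBy_discreteCrossing_edgeSet`), so its probability under the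
product measure `bondPercolation (zdGraph 2) half = setBer(E(ℤ²), 1/2)` is the cylinder sum
`Σ_{S ⊆ E(Ω_δ), S ∈ C_δ} ∏_{e ∈ E(Ω_δ)} (1/2)` (`Russo.measureReal_eq_cylPoly`, all one-coordinate
weights being `1/2` because `E(Ω_δ) ⊆ E(ℤ²)`), the same number.

References: G. Grimmett, *The Random-Cluster Model* (2006), §1.3 ("when `q = 1` this is a product
measure"); G. Grimmett, *Percolation*, 2nd ed. (1999), §2.2 (cylinder events); S. Smirnov,
C. R. Acad. Sci. 333 (2001), §2 (the crossing event).
-/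

noncomputable section

namespace Summit.CriticalPhenomena.CardyFormulaZ2.Theorems

open MeasureTheory Set
open Literature.Probability.LatticeModels Literature.Probability.Percolation
open scoped ProbabilityTheory

/-! ### Locality of the crossing event -/

/-- Smirnov's crossing event `C_δ(Ω; A, B) = discreteCrossing Ω δ A B` is determined by the edge SET
of the discrete domain `Ω_δ` (it is read off `openGraph ω ⊓ Ω_δ`; instance-free form of
`determinedBy_discreteCrossing` of `Theorems/CardyUSTContinuationBernoulliEndpoint.lean`, via its
`mem_discreteCrossing_iff_of_inter_edgeSet_eq`). (Smirnov 2001, §2; Grimmett 1999, §2.2.) -/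
theorem determinedBy_discreteCrossing_edgeSet (Ω : Set ℂ) (δ : ℝ) (A B : Set ℂ) :
    DeterminedBy (discreteCrossing Ω δ A B) (discreteDomainGraph Ω δ).edgeSet := by
  rw [determinedBy_iff]
  intro ω ω' h
  exact mem_discreteCrossing_iff_of_inter_edgeSet_eq h

/-! ### Counting: product measure at `p = 1/2` and `finsum`s over a finite power set -/

open Classical in
/-- At `p = 1/2` Russo's cylinder polynomial of an event `B` over a finite set `K ⊆ u` of
coordinates is `#{S ⊆ K : S ∈ B} / 2 ^ #K`: every one-coordinate weight is `1/2`.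
(Grimmett 1999, §2.2.) -/
theorem cylPoly_half_eq_sum_div {ι : Type*} {u : Set ι} {K : Finset ι} (hK : (↑K : Set ι) ⊆ u)
    (B : Set (Set ι)) :
    Russo.cylPoly u K B (1 / 2) =
      (∑ S ∈ K.powerset, if (↑S : Set ι) ∈ B then (1 : ℝ) else 0) / 2 ^ K.card := by
  have hw : ∀ S : Finset ι, ∏ i ∈ K, Russo.weight u (↑S : Set ι) i (1 / 2 : ℝ) = (1 / 2) ^ K.card := by
    intro S
    rw [← Finset.prod_const]
    refine Finset.prod_congr rfl fun i hi => ?_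
    have hiu : i ∈ u := hK (Finset.mem_coe.2 hi)
    by_cases hS : i ∈ (↑S : Set ι)
    · simp [Russo.weight, hS, hiu]
    · simp only [Russo.weight, hS, hiu, if_true, if_false]; norm_num
  simp only [Russo.cylPoly, hw]
  rw [Finset.sum_div]
  refine Finset.sum_congr rfl fun S _ => ?_
  split_ifs <;> simp [div_eq_mul_inv]

open Classical in
/-- Under `setBer(u, 1/2)` an event determined by a finite set `K ⊆ u` of coordinates has
probability `#{S ⊆ K : S ∈ B} / 2 ^ #K` (finite-dimensional marginal of the product measure,
`Russo.measureReal_eq_cylPoly`). (Grimmett 1999, §2.2.) -/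
theorem setBernoulli_half_real_eq_sum_div {ι : Type*} {u : Set ι} {K : Finset ι}
    (hK : (↑K : Set ι) ⊆ u) {B : Set (Set ι)} (hB : DeterminedBy B ↑K) :
    (setBer(u, half)).real B =
      (∑ S ∈ K.powerset, if (↑S : Set ι) ∈ B then (1 : ℝ) else 0) / 2 ^ K.card := by
  rw [Russo.measureReal_eq_cylPoly hB u half, coe_half, cylPoly_half_eq_sum_div hK B]

/-- The power set of a finite set `↑K` is the image of `K.powerset` under the coercion
`Finset ι → Set ι`. -/
theorem powerset_coe_eq_image_powerset {ι : Type*} (K : Finset ι) :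
    𝒫 (↑K : Set ι) = ((↑) : Finset ι → Set ι) '' ↑K.powerset := by
  rw [Finset.coe_powerset, Set.image_preimage_eq_inter_range, eq_comm, Set.inter_eq_left]
  intro S hS
  exact ⟨(K.finite_toSet.subset hS).toFinset, Set.Finite.coe_toFinset _⟩

/-- A `finsum` over the power set of a finite set `↑K` is the `Finset.sum` over `K.powerset`. -/
theorem finsum_mem_powerset_coe {ι M : Type*} [AddCommMonoid M] (K : Finset ι) (f : Set ι → M) :
    ∑ᶠ ω ∈ 𝒫 (↑K : Set ι), f ω = ∑ T ∈ K.powerset, f ↑T := by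
  rw [powerset_coe_eq_image_powerset, finsum_mem_image Finset.coe_injective.injOn,
    finsum_mem_coe_finset]

/-! ### The item -/

/-- **`BernoulliMatch`** (item stmt-CriticalPhenomena-5562 of route CardyQContinuation): for every
conformal rectangle `R` and every `δ > 0`, the self-dual arc crossing ratio at `s = 1`,
`P_δ(1) = (Σ_{ω ⊆ E(Ω_δ), ω ∈ C_δ} 1) / (Σ_{ω ⊆ E(Ω_δ)} 1)`, equals the Bernoulli-`1/2` crossing
probability `bondDomainCrossingProb R δ = P_{1/2}(C_δ)`: all weights are `1`, `E(Ω_δ)` is finite,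
and `C_δ` is determined by the edges of `Ω_δ`, on which `P_{1/2}` is uniform.
(Grimmett 2006, §1.3; Grimmett 1999, §2.2; Smirnov 2001, §2.) -/
theorem BernoulliMatch_proof :
    Summit.CriticalPhenomena.CardyFormulaZ2.Theses.CardyQContinuation.BernoulliMatch := by
  classical
  intro R δ hδ
  simp only [one_pow]
  -- the edge set of `Ω_δ` is finite (every edge joins two sites of the finite `meshDomain`;
  -- cf. `finite_edgeSet_discreteDomainGraph` of Theorems/CardyComplexConeEdgePrecompact…, not
  -- imported), say `↑K`
  have hfinE : (discreteDomainGraph R.carrier δ).edgeSet.Finite := by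
    have hfin := meshDomain_finite R.isBounded hδ
    refine ((hfin.prod hfin).image fun p : Site 2 × Site 2 => s(p.1, p.2)).subset ?_
    intro e he
    induction e using Sym2.ind with
    | h x y =>
      obtain ⟨-, hx, hy⟩ := discreteDomainGraph_adj_iff.1 ((SimpleGraph.mem_edgeSet _).1 he)
      exact ⟨(x, y), ⟨hx, hy⟩, rfl⟩
  obtain ⟨K, hK⟩ : ∃ K : Finset (Sym2 (Site 2)), ↑K = (discreteDomainGraph R.carrier δ).edgeSet :=
    ⟨hfinE.toFinset, Set.Finite.coe_toFinset _⟩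
  have hdet := determinedBy_discreteCrossing_edgeSet R.carrier δ (R.arc 0) (R.arc 2)
  rw [← hK] at hdet ⊢
  have hKu : (↑K : Set (Sym2 (Site 2))) ⊆ (zdGraph 2).edgeSet :=
    hK ▸ SimpleGraph.edgeSet_mono ((discreteDomainGraph_le_meshGraph _ _).trans (meshGraph_le_zdGraph _ _))
  rw [finsum_mem_powerset_coe, finsum_mem_powerset_coe, bondDomainCrossingProb_eq_measureReal,
    bondPercolation, setBernoulli_half_real_eq_sum_div hKu hdet]
  simp only [Set.indicator_apply, Finset.sum_boole, Finset.sum_const, Finset.card_powerset,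
    nsmul_eq_mul, mul_one]
  push_cast
  ring
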